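import Summits.QuantumFields.YangMills.Theorems.ParabolicTrajectoryContinuumLimitOnTrajectoryUclTailsB

/-!
# Crux `ContinuumLimitOnTrajectory` (stmt-QuantumFields-10522), line `two-orbit-synchronisation` (seat c2):
# tail terms of the core clustering estimate — the eight bounds

Helper file (`--supports stmt-QuantumFields-10522`) for the registered stub `stub_uclOfGap : UCLOfGap`, wave 2,
worker W2-TAILS; registered anchor `tail_terms_bound`. With `ρ = rhoK sch k = √(a_k L_k)`, `s₀ = t b₀`,
`X = Low`, `Y = T_{tb} Up` and the pieces `lowMain/lowMid/lowFar ρ s₀ X`, `upMain/upMid/upFar ρ s₀ Y` of `…UclDefs`,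
the eight tail terms `‖covc r sch k piece piece'‖` (all pairs but `(lowMain, upMain)`) are `≤ ε/8` for `t ≥ t₀`,
eventually in `k`:

* the five FAR pairs (a `lowFar` or an `upFar`; `far_lowMain_upFar`, …) by the sup-norm mechanism `far_generic` of
  `…UclTailsB` — for every `t ≥ 0`, eventually in `k` (Schwartz tail `ρ_k^{-N}` of the far piece against `a_k^{-4(n₁+n₂)}`,
  `PolyVolumeGrowth`);
* the three MID pairs (`mid_lowMain_upMid`, `mid_lowMid_upMain`, `mid_lowMid_upMid`) by the `UUVB` mechanism
  `mid_generic` — for `t ≥ t₀`, at every `k` beyond the `UUVB` threshold (decay `(t b₀/4)^{-(M+1)}` of the mid piece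
  against the growth `(2(1+t‖b‖))^M` of the translated factor; off-diagonality of pieces and pairs from the locus-avoidance
  hypotheses via the support inclusions of `…UclTailsA`).

Refs: Glimm–Jaffe 1987 §19.7; Osterwalder–Schrader 1973 §2.
-/

set_option autoImplicit false

open scoped SchwartzMap
open MeasureTheory Filter Topology Set
open Literature.MathematicalPhysics.QuantumFieldTheory Literature.MathematicalPhysics.QuantumLattice
open Literature.MathematicalPhysics.AQFT Literature.Probability.LatticeModels

noncomputable section

namespace Summit.QuantumFields.YangMills.Cruxes.ContinuumLimitOnTrajectory.TwoOrbitSynchronisation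

namespace Tails

section Pairs

variable {G : Type} [Group G] [TopologicalSpace G] [IsTopologicalGroup G] [CompactSpace G]
  [MeasurableSpace G] [BorelSpace G]

/-- A uniform piece bound after the translated factor: `|P (T_{tb} Up)|_M ≤ C (2(1+‖tb‖))^M |Up|_M`. -/
theorem piece_translate_le {p M : ℕ} {C : ℝ} (hC0 : 0 ≤ C)
    {P : 𝓢((Fin p → EuclideanSpace ℝ (Fin 4)), ℂ) → 𝓢((Fin p → EuclideanSpace ℝ (Fin 4)), ℂ)}
    (hP : ∀ Y : 𝓢((Fin p → EuclideanSpace ℝ (Fin 4)), ℂ), schwartzNorm M (P Y) ≤ C * schwartzNorm M Y) (t : ℝ)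
    (b : EuclideanSpace ℝ (Fin 4)) (Up : 𝓢((Fin p → EuclideanSpace ℝ (Fin 4)), ℂ)) :
    schwartzNorm M (P (translateMulti (t • b) Up)) ≤ C * ((2 * (1 + ‖t • b‖)) ^ M * schwartzNorm M Up) :=
  (hP _).trans (mul_le_mul_of_nonneg_left (schwartzNorm_translateMulti_le M (t • b) Up) hC0)

/-! ## The five FAR pairs: for every `t ≥ 0`, eventually in `k` -/

/-- FAR pair `(lowMain, upFar)`. -/
theorem far_lowMain_upFar (r : LatticeRep G) (sch : SpeciesScheme (YMSpecies G)) (hvol : PolyVolumeGrowth sch) (n₁ n₂ : ℕ)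
    (Low : 𝓢((Fin n₁ → EuclideanSpace ℝ (Fin 4)), ℂ)) (Up : 𝓢((Fin n₂ → EuclideanSpace ℝ (Fin 4)), ℂ))
    (b : EuclideanSpace ℝ (Fin 4)) (hb : 0 < b 0) {δ : ℝ} (hδ : 0 < δ) (t : ℝ) (ht : 0 ≤ t) : ∀ᶠ k in atTop,
      ‖covc r sch k (lowMain (rhoK sch k) (t * b 0) Low) (upFar (rhoK sch k) (t * b 0) (translateMulti (t • b) Up))‖ ≤ δ := by
  obtain ⟨C, -, hC⟩ := Transl.exists_uniform_bound_cw r sch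
  obtain ⟨N, hN⟩ := far_smallness sch hvol n₁ n₂
  obtain ⟨C₁, h₁0, h₁⟩ := exists_bound_lowMain n₁ (8 * n₁)
  obtain ⟨C₂, h₂0, h₂⟩ := exists_decay_upFar n₂ (8 * n₂) N
  have hLn := schwartzNorm_nonneg (8 * n₁) Low
  have hUn := schwartzNorm_nonneg (8 * n₂ + N) Up
  have hs0 : 0 ≤ t * b 0 := mul_nonneg ht hb.le
  refine far_generic r sch hC hN (fun k => lowMain (rhoK sch k) (t * b 0) Low)
    (fun k => upFar (rhoK sch k) (t * b 0) (translateMulti (t • b) Up))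
    (K := C₁ * schwartzNorm (8 * n₁) Low * (C₂ * ((2 * (1 + ‖t • b‖)) ^ (8 * n₂ + N) * schwartzNorm (8 * n₂ + N) Up)))
    (by positivity) (fun k hρ => ?_) hδ
  have hρ0 : 0 < rhoK sch k := one_pos.trans_le hρ
  have hsρ : 0 < t * b 0 + rhoK sch k := by linarith
  have a1 : schwartzNorm (8 * n₁) (lowMain (rhoK sch k) (t * b 0) Low) ≤ C₁ * schwartzNorm (8 * n₁) Low := h₁ _ _ _
  have a2 : schwartzNorm (8 * n₂) (upFar (rhoK sch k) (t * b 0) (translateMulti (t • b) Up)) ≤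
      C₂ * (rhoK sch k)⁻¹ ^ N * ((2 * (1 + ‖t • b‖)) ^ (8 * n₂ + N) * schwartzNorm (8 * n₂ + N) Up) := by
    refine (h₂ _ _ _ hsρ).trans ?_
    have hinv : (t * b 0 + rhoK sch k)⁻¹ ^ N ≤ (rhoK sch k)⁻¹ ^ N :=
      pow_le_pow_left₀ (inv_nonneg.2 hsρ.le) (inv_anti₀ hρ0 (le_add_of_nonneg_left hs0)) N
    exact mul_le_mul (mul_le_mul_of_nonneg_left hinv h₂0) (schwartzNorm_translateMulti_le _ (t • b) Up)
      (schwartzNorm_nonneg _ _) (mul_nonneg h₂0 (pow_nonneg (inv_nonneg.2 hρ0.le) _))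
  calc _ ≤ (C₁ * schwartzNorm (8 * n₁) Low) *
        (C₂ * (rhoK sch k)⁻¹ ^ N * ((2 * (1 + ‖t • b‖)) ^ (8 * n₂ + N) * schwartzNorm (8 * n₂ + N) Up)) :=
        mul_le_mul a1 a2 (schwartzNorm_nonneg _ _) (by positivity)
    _ = _ := by rw [inv_pow]; ring

/-- FAR pair `(lowMid, upFar)`. -/
theorem far_lowMid_upFar (r : LatticeRep G) (sch : SpeciesScheme (YMSpecies G)) (hvol : PolyVolumeGrowth sch) (n₁ n₂ : ℕ)
    (Low : 𝓢((Fin n₁ → EuclideanSpace ℝ (Fin 4)), ℂ)) (Up : 𝓢((Fin n₂ → EuclideanSpace ℝ (Fin 4)), ℂ))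
    (b : EuclideanSpace ℝ (Fin 4)) (hb : 0 < b 0) {δ : ℝ} (hδ : 0 < δ) (t : ℝ) (ht : 0 ≤ t) : ∀ᶠ k in atTop,
      ‖covc r sch k (lowMid (rhoK sch k) (t * b 0) Low) (upFar (rhoK sch k) (t * b 0) (translateMulti (t • b) Up))‖ ≤ δ := by
  obtain ⟨C, -, hC⟩ := Transl.exists_uniform_bound_cw r sch
  obtain ⟨N, hN⟩ := far_smallness sch hvol n₁ n₂
  obtain ⟨C₁, h₁0, h₁⟩ := exists_bound_lowMid n₁ (8 * n₁)
  obtain ⟨C₂, h₂0, h₂⟩ := exists_decay_upFar n₂ (8 * n₂) N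
  have hLn := schwartzNorm_nonneg (8 * n₁) Low
  have hUn := schwartzNorm_nonneg (8 * n₂ + N) Up
  have hs0 : 0 ≤ t * b 0 := mul_nonneg ht hb.le
  refine far_generic r sch hC hN (fun k => lowMid (rhoK sch k) (t * b 0) Low)
    (fun k => upFar (rhoK sch k) (t * b 0) (translateMulti (t • b) Up))
    (K := C₁ * schwartzNorm (8 * n₁) Low * (C₂ * ((2 * (1 + ‖t • b‖)) ^ (8 * n₂ + N) * schwartzNorm (8 * n₂ + N) Up)))
    (by positivity) (fun k hρ => ?_) hδ
  have hρ0 : 0 < rhoK sch k := one_pos.trans_le hρ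
  have hsρ : 0 < t * b 0 + rhoK sch k := by linarith
  have a1 : schwartzNorm (8 * n₁) (lowMid (rhoK sch k) (t * b 0) Low) ≤ C₁ * schwartzNorm (8 * n₁) Low := h₁ _ _ _
  have a2 : schwartzNorm (8 * n₂) (upFar (rhoK sch k) (t * b 0) (translateMulti (t • b) Up)) ≤
      C₂ * (rhoK sch k)⁻¹ ^ N * ((2 * (1 + ‖t • b‖)) ^ (8 * n₂ + N) * schwartzNorm (8 * n₂ + N) Up) := by
    refine (h₂ _ _ _ hsρ).trans ?_
    have hinv : (t * b 0 + rhoK sch k)⁻¹ ^ N ≤ (rhoK sch k)⁻¹ ^ N :=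
      pow_le_pow_left₀ (inv_nonneg.2 hsρ.le) (inv_anti₀ hρ0 (le_add_of_nonneg_left hs0)) N
    exact mul_le_mul (mul_le_mul_of_nonneg_left hinv h₂0) (schwartzNorm_translateMulti_le _ (t • b) Up)
      (schwartzNorm_nonneg _ _) (mul_nonneg h₂0 (pow_nonneg (inv_nonneg.2 hρ0.le) _))
  calc _ ≤ (C₁ * schwartzNorm (8 * n₁) Low) *
        (C₂ * (rhoK sch k)⁻¹ ^ N * ((2 * (1 + ‖t • b‖)) ^ (8 * n₂ + N) * schwartzNorm (8 * n₂ + N) Up)) :=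
        mul_le_mul a1 a2 (schwartzNorm_nonneg _ _) (by positivity)
    _ = _ := by rw [inv_pow]; ring

/-- FAR pairs `(lowFar, P (T_{tb} Up))` for any uniformly bounded operation `P` on the upper factor. -/
theorem far_lowFar_any (r : LatticeRep G) (sch : SpeciesScheme (YMSpecies G)) (hvol : PolyVolumeGrowth sch) (n₁ n₂ : ℕ)
    (Low : 𝓢((Fin n₁ → EuclideanSpace ℝ (Fin 4)), ℂ)) (Up : 𝓢((Fin n₂ → EuclideanSpace ℝ (Fin 4)), ℂ))
    (b : EuclideanSpace ℝ (Fin 4)) {δ : ℝ} (hδ : 0 < δ) (t : ℝ)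
    (P : ℝ → 𝓢((Fin n₂ → EuclideanSpace ℝ (Fin 4)), ℂ) → 𝓢((Fin n₂ → EuclideanSpace ℝ (Fin 4)), ℂ))
    {C₂ : ℝ} (h₂0 : 0 ≤ C₂) (h₂ : ∀ (ρ : ℝ) (Y : 𝓢((Fin n₂ → EuclideanSpace ℝ (Fin 4)), ℂ)),
      schwartzNorm (8 * n₂) (P ρ Y) ≤ C₂ * schwartzNorm (8 * n₂) Y) :
    ∀ᶠ k in atTop, ‖covc r sch k (lowFar (rhoK sch k) Low) (P (rhoK sch k) (translateMulti (t • b) Up))‖ ≤ δ := by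
  obtain ⟨C, -, hC⟩ := Transl.exists_uniform_bound_cw r sch
  obtain ⟨N, hN⟩ := far_smallness sch hvol n₁ n₂
  obtain ⟨C₁, h₁0, h₁⟩ := exists_decay_lowFar n₁ (8 * n₁) N
  have hLn := schwartzNorm_nonneg (8 * n₁ + N) Low
  have hUn := schwartzNorm_nonneg (8 * n₂) Up
  refine far_generic r sch hC hN (fun k => lowFar (rhoK sch k) Low) (fun k => P (rhoK sch k) (translateMulti (t • b) Up))
    (K := C₁ * schwartzNorm (8 * n₁ + N) Low * (C₂ * ((2 * (1 + ‖t • b‖)) ^ (8 * n₂) * schwartzNorm (8 * n₂) Up)))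
    (by positivity) (fun k hρ => ?_) hδ
  have hρ0 : 0 < rhoK sch k := one_pos.trans_le hρ
  have a1 : schwartzNorm (8 * n₁) (lowFar (rhoK sch k) Low) ≤ C₁ * (rhoK sch k)⁻¹ ^ N * schwartzNorm (8 * n₁ + N) Low :=
    h₁ _ _ hρ0
  have a2 := piece_translate_le h₂0 (h₂ (rhoK sch k)) t b Up
  calc _ ≤ (C₁ * (rhoK sch k)⁻¹ ^ N * schwartzNorm (8 * n₁ + N) Low) *
        (C₂ * ((2 * (1 + ‖t • b‖)) ^ (8 * n₂) * schwartzNorm (8 * n₂) Up)) :=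
        mul_le_mul a1 a2 (schwartzNorm_nonneg _ _) (by positivity)
    _ = _ := by rw [inv_pow]; ring

/-- FAR pair `(lowFar, upMain)`. -/
theorem far_lowFar_upMain (r : LatticeRep G) (sch : SpeciesScheme (YMSpecies G)) (hvol : PolyVolumeGrowth sch) (n₁ n₂ : ℕ)
    (Low : 𝓢((Fin n₁ → EuclideanSpace ℝ (Fin 4)), ℂ)) (Up : 𝓢((Fin n₂ → EuclideanSpace ℝ (Fin 4)), ℂ))
    (b : EuclideanSpace ℝ (Fin 4)) {δ : ℝ} (hδ : 0 < δ) (t : ℝ) : ∀ᶠ k in atTop,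
      ‖covc r sch k (lowFar (rhoK sch k) Low) (upMain (rhoK sch k) (t * b 0) (translateMulti (t • b) Up))‖ ≤ δ := by
  obtain ⟨C₂, h₂0, h₂⟩ := exists_bound_upMain n₂ (8 * n₂)
  exact far_lowFar_any r sch hvol n₁ n₂ Low Up b hδ t (fun ρ Y => upMain ρ (t * b 0) Y) h₂0 fun ρ Y => h₂ ρ _ Y

/-- FAR pair `(lowFar, upMid)`. -/
theorem far_lowFar_upMid (r : LatticeRep G) (sch : SpeciesScheme (YMSpecies G)) (hvol : PolyVolumeGrowth sch) (n₁ n₂ : ℕ)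
    (Low : 𝓢((Fin n₁ → EuclideanSpace ℝ (Fin 4)), ℂ)) (Up : 𝓢((Fin n₂ → EuclideanSpace ℝ (Fin 4)), ℂ))
    (b : EuclideanSpace ℝ (Fin 4)) {δ : ℝ} (hδ : 0 < δ) (t : ℝ) : ∀ᶠ k in atTop,
      ‖covc r sch k (lowFar (rhoK sch k) Low) (upMid (rhoK sch k) (t * b 0) (translateMulti (t • b) Up))‖ ≤ δ := by
  obtain ⟨C₂, h₂0, h₂⟩ := exists_bound_upMid n₂ (8 * n₂)
  exact far_lowFar_any r sch hvol n₁ n₂ Low Up b hδ t (fun ρ Y => upMid ρ (t * b 0) Y) h₂0 fun ρ Y => h₂ ρ _ Y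

/-- FAR pair `(lowFar, upFar)`. -/
theorem far_lowFar_upFar (r : LatticeRep G) (sch : SpeciesScheme (YMSpecies G)) (hvol : PolyVolumeGrowth sch) (n₁ n₂ : ℕ)
    (Low : 𝓢((Fin n₁ → EuclideanSpace ℝ (Fin 4)), ℂ)) (Up : 𝓢((Fin n₂ → EuclideanSpace ℝ (Fin 4)), ℂ))
    (b : EuclideanSpace ℝ (Fin 4)) {δ : ℝ} (hδ : 0 < δ) (t : ℝ) : ∀ᶠ k in atTop,
      ‖covc r sch k (lowFar (rhoK sch k) Low) (upFar (rhoK sch k) (t * b 0) (translateMulti (t • b) Up))‖ ≤ δ := by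
  obtain ⟨C₂, h₂0, h₂⟩ := exists_bound_upFar n₂ (8 * n₂)
  exact far_lowFar_any r sch hvol n₁ n₂ Low Up b hδ t (fun ρ Y => upFar ρ (t * b 0) Y) h₂0 fun ρ Y => h₂ ρ _ Y

/-! ## The three MID pairs: for `t ≥ t₀`, at every `k` beyond the `UUVB` threshold -/

/-- MID pair `(lowMid, upMain)`. -/
theorem mid_lowMid_upMain (r : LatticeRep G) (sch : SpeciesScheme (YMSpecies G)) (hU : UUVB r sch) (n₁ n₂ : ℕ)
    (Low : 𝓢((Fin n₁ → EuclideanSpace ℝ (Fin 4)), ℂ)) (Up : 𝓢((Fin n₂ → EuclideanSpace ℝ (Fin 4)), ℂ))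
    (b : EuclideanSpace ℝ (Fin 4)) (hLow : AvoidsLocus Low) (hUp : AvoidsLocus Up) (hb : 0 < b 0)
    (hLU : ∀ t : ℝ, AvoidsLocus (Low.appendTensor (translateMulti (t • b) Up))) {δ : ℝ} (hδ : 0 < δ) :
    ∃ t₀ : ℝ, ∀ t : ℝ, t₀ ≤ t → ∀ᶠ k in atTop,
      ‖covc r sch k (lowMid (rhoK sch k) (t * b 0) Low) (upMain (rhoK sch k) (t * b 0) (translateMulti (t • b) Up))‖ ≤ δ := by
  obtain ⟨s, α, β, hk⟩ := Transl.norm_curvDistribution_le_of_uuvb r sch hU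
  obtain ⟨C₁, h₁0, h₁⟩ := exists_decay_lowMid n₁ ((n₁ + n₂) * s) ((n₁ + n₂) * s + 1)
  obtain ⟨C₂, h₂0, h₂⟩ := exists_bound_upMain n₂ ((n₁ + n₂) * s)
  have hLn := schwartzNorm_nonneg ((n₁ + n₂) * s + ((n₁ + n₂) * s + 1)) Low
  have hUn := schwartzNorm_nonneg ((n₁ + n₂) * s) Up
  refine mid_generic r sch hk (fun t k => lowMid (rhoK sch k) (t * b 0) Low)
    (fun t k => upMain (rhoK sch k) (t * b 0) (translateMulti (t • b) Up))
    (fun t k => (hLow.of_tsupport_subset (tsupport_lowMid_subset _ _ _)).isOffDiagonal)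
    (fun t k => ((hUp.translateMulti (t • b)).of_tsupport_subset (tsupport_upMain_subset _ _ _)).isOffDiagonal)
    (fun t k => (avoidsLocus_appendTensor_mono (hLU t) (tsupport_lowMid_subset _ _ _)
      (tsupport_upMain_subset _ _ _)).isOffDiagonal)
    (K := C₁ * schwartzNorm ((n₁ + n₂) * s + ((n₁ + n₂) * s + 1)) Low * (C₂ * schwartzNorm ((n₁ + n₂) * s) Up))
    (B := ‖b‖) (b₀ := b 0) (by positivity) (norm_nonneg b) hb (fun t k ht1 => ?_) hδ
  have ht0 : 0 ≤ t := zero_le_one.trans ht1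
  have hs : 0 < t * b 0 := mul_pos (one_pos.trans_le ht1) hb
  have a1 := h₁ (rhoK sch k) (t * b 0) Low hs
  have a2 := piece_translate_le h₂0 (h₂ (rhoK sch k) (t * b 0)) t b Up
  calc _ ≤ (C₁ * (t * b 0 / 4)⁻¹ ^ ((n₁ + n₂) * s + 1) * schwartzNorm ((n₁ + n₂) * s + ((n₁ + n₂) * s + 1)) Low) *
        (C₂ * ((2 * (1 + ‖t • b‖)) ^ ((n₁ + n₂) * s) * schwartzNorm ((n₁ + n₂) * s) Up)) :=
        mul_le_mul a1 a2 (schwartzNorm_nonneg _ _) (by positivity)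
    _ = _ := by rw [norm_smul, Real.norm_eq_abs, abs_of_nonneg ht0]; ring

/-- MID pair `(lowMain, upMid)`. -/
theorem mid_lowMain_upMid (r : LatticeRep G) (sch : SpeciesScheme (YMSpecies G)) (hU : UUVB r sch) (n₁ n₂ : ℕ)
    (Low : 𝓢((Fin n₁ → EuclideanSpace ℝ (Fin 4)), ℂ)) (Up : 𝓢((Fin n₂ → EuclideanSpace ℝ (Fin 4)), ℂ))
    (b : EuclideanSpace ℝ (Fin 4)) (hLow : AvoidsLocus Low) (hUp : AvoidsLocus Up) (hb : 0 < b 0)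
    (hLU : ∀ t : ℝ, AvoidsLocus (Low.appendTensor (translateMulti (t • b) Up))) {δ : ℝ} (hδ : 0 < δ) :
    ∃ t₀ : ℝ, ∀ t : ℝ, t₀ ≤ t → ∀ᶠ k in atTop,
      ‖covc r sch k (lowMain (rhoK sch k) (t * b 0) Low) (upMid (rhoK sch k) (t * b 0) (translateMulti (t • b) Up))‖ ≤ δ := by
  obtain ⟨s, α, β, hk⟩ := Transl.norm_curvDistribution_le_of_uuvb r sch hU
  obtain ⟨C₁, h₁0, h₁⟩ := exists_bound_lowMain n₁ ((n₁ + n₂) * s)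
  obtain ⟨C₂, h₂0, h₂⟩ := exists_decay_upMid n₂ ((n₁ + n₂) * s) ((n₁ + n₂) * s + 1)
  have hLn := schwartzNorm_nonneg ((n₁ + n₂) * s) Low
  have hUn := schwartzNorm_nonneg ((n₁ + n₂) * s + ((n₁ + n₂) * s + 1)) Up
  refine mid_generic r sch hk (fun t k => lowMain (rhoK sch k) (t * b 0) Low)
    (fun t k => upMid (rhoK sch k) (t * b 0) (translateMulti (t • b) Up))
    (fun t k => (hLow.of_tsupport_subset (tsupport_lowMain_subset _ _ _)).isOffDiagonal)
    (fun t k => ((hUp.translateMulti (t • b)).of_tsupport_subset (tsupport_upMid_subset _ _ _)).isOffDiagonal)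
    (fun t k => (avoidsLocus_appendTensor_mono (hLU t) (tsupport_lowMain_subset _ _ _)
      (tsupport_upMid_subset _ _ _)).isOffDiagonal)
    (K := C₁ * schwartzNorm ((n₁ + n₂) * s) Low * (C₂ * schwartzNorm ((n₁ + n₂) * s + ((n₁ + n₂) * s + 1)) Up))
    (B := ‖b‖) (b₀ := b 0) (by positivity) (norm_nonneg b) hb (fun t k ht1 => ?_) hδ
  have ht0 : 0 ≤ t := zero_le_one.trans ht1
  have hs : 0 < t * b 0 := mul_pos (one_pos.trans_le ht1) hb
  have hT : 0 ≤ (2 * (1 + ‖t • b‖)) ^ ((n₁ + n₂) * s) := by positivity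
  have a1 : schwartzNorm ((n₁ + n₂) * s) (lowMain (rhoK sch k) (t * b 0) Low) ≤ C₁ * schwartzNorm ((n₁ + n₂) * s) Low :=
    h₁ _ _ _
  have a2 := h₂ (rhoK sch k) t b Up hs
  calc _ ≤ (C₁ * schwartzNorm ((n₁ + n₂) * s) Low) * (C₂ * (2 * (1 + ‖t • b‖)) ^ ((n₁ + n₂) * s) *
        (t * b 0 / 4)⁻¹ ^ ((n₁ + n₂) * s + 1) * schwartzNorm ((n₁ + n₂) * s + ((n₁ + n₂) * s + 1)) Up) :=
        mul_le_mul a1 a2 (schwartzNorm_nonneg _ _) (by positivity)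
    _ = _ := by rw [norm_smul, Real.norm_eq_abs, abs_of_nonneg ht0]; ring

/-- MID pair `(lowMid, upMid)`. -/
theorem mid_lowMid_upMid (r : LatticeRep G) (sch : SpeciesScheme (YMSpecies G)) (hU : UUVB r sch) (n₁ n₂ : ℕ)
    (Low : 𝓢((Fin n₁ → EuclideanSpace ℝ (Fin 4)), ℂ)) (Up : 𝓢((Fin n₂ → EuclideanSpace ℝ (Fin 4)), ℂ))
    (b : EuclideanSpace ℝ (Fin 4)) (hLow : AvoidsLocus Low) (hUp : AvoidsLocus Up) (hb : 0 < b 0)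
    (hLU : ∀ t : ℝ, AvoidsLocus (Low.appendTensor (translateMulti (t • b) Up))) {δ : ℝ} (hδ : 0 < δ) :
    ∃ t₀ : ℝ, ∀ t : ℝ, t₀ ≤ t → ∀ᶠ k in atTop,
      ‖covc r sch k (lowMid (rhoK sch k) (t * b 0) Low) (upMid (rhoK sch k) (t * b 0) (translateMulti (t • b) Up))‖ ≤ δ := by
  obtain ⟨s, α, β, hk⟩ := Transl.norm_curvDistribution_le_of_uuvb r sch hU
  obtain ⟨C₁, h₁0, h₁⟩ := exists_decay_lowMid n₁ ((n₁ + n₂) * s) ((n₁ + n₂) * s + 1)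
  obtain ⟨C₂, h₂0, h₂⟩ := exists_bound_upMid n₂ ((n₁ + n₂) * s)
  have hLn := schwartzNorm_nonneg ((n₁ + n₂) * s + ((n₁ + n₂) * s + 1)) Low
  have hUn := schwartzNorm_nonneg ((n₁ + n₂) * s) Up
  refine mid_generic r sch hk (fun t k => lowMid (rhoK sch k) (t * b 0) Low)
    (fun t k => upMid (rhoK sch k) (t * b 0) (translateMulti (t • b) Up))
    (fun t k => (hLow.of_tsupport_subset (tsupport_lowMid_subset _ _ _)).isOffDiagonal)
    (fun t k => ((hUp.translateMulti (t • b)).of_tsupport_subset (tsupport_upMid_subset _ _ _)).isOffDiagonal)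
    (fun t k => (avoidsLocus_appendTensor_mono (hLU t) (tsupport_lowMid_subset _ _ _)
      (tsupport_upMid_subset _ _ _)).isOffDiagonal)
    (K := C₁ * schwartzNorm ((n₁ + n₂) * s + ((n₁ + n₂) * s + 1)) Low * (C₂ * schwartzNorm ((n₁ + n₂) * s) Up))
    (B := ‖b‖) (b₀ := b 0) (by positivity) (norm_nonneg b) hb (fun t k ht1 => ?_) hδ
  have ht0 : 0 ≤ t := zero_le_one.trans ht1
  have hs : 0 < t * b 0 := mul_pos (one_pos.trans_le ht1) hb
  have a1 := h₁ (rhoK sch k) (t * b 0) Low hs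
  have a2 := piece_translate_le h₂0 (h₂ (rhoK sch k) (t * b 0)) t b Up
  calc _ ≤ (C₁ * (t * b 0 / 4)⁻¹ ^ ((n₁ + n₂) * s + 1) * schwartzNorm ((n₁ + n₂) * s + ((n₁ + n₂) * s + 1)) Low) *
        (C₂ * ((2 * (1 + ‖t • b‖)) ^ ((n₁ + n₂) * s) * schwartzNorm ((n₁ + n₂) * s) Up)) :=
        mul_le_mul a1 a2 (schwartzNorm_nonneg _ _) (by positivity)
    _ = _ := by rw [norm_smul, Real.norm_eq_abs, abs_of_nonneg ht0]; ring

end Pairs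

end Tails

/-! ## The registered anchor -/

/-- **The eight tail terms of the core clustering estimate** (registered anchor `tail_terms_bound`). Under
`PolyVolumeGrowth` and `UUVB`, for locus-avoiding `Low`, `Up`, a translation direction `b` with `0 < b 0` such that every
`Low ⊗ T_{tb} Up` avoids the locus, and `ε > 0`: there is `t₀` such that for all `t ≥ t₀`, eventually in `k`, every one of
the eight tail terms of the nine-term expansion of `covc r sch k Low (T_{tb} Up)` (all pairs of pieces except the main pair
`(lowMain, upMain)`, with `ρ = rhoK sch k`, `s₀ = t b₀`) is at most `ε / 8`. -/
theorem tail_terms_bound : ∀ {G : Type} [Group G] [TopologicalSpace G] [IsTopologicalGroup G] [CompactSpace G]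
    [MeasurableSpace G] [BorelSpace G] (r : LatticeRep G) (sch : SpeciesScheme (YMSpecies G)),
    PolyVolumeGrowth sch → UUVB r sch →
    ∀ (n₁ n₂ : ℕ) (Low : 𝓢((Fin n₁ → EuclideanSpace ℝ (Fin 4)), ℂ)) (Up : 𝓢((Fin n₂ → EuclideanSpace ℝ (Fin 4)), ℂ))
      (b : EuclideanSpace ℝ (Fin 4)),
    AvoidsLocus Low → AvoidsLocus Up → 0 < b 0 → (∀ t : ℝ, AvoidsLocus (Low.appendTensor (translateMulti (t • b) Up))) →
    ∀ ε : ℝ, 0 < ε → ∃ t₀ : ℝ, ∀ t : ℝ, t₀ ≤ t → ∀ᶠ k in atTop,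
      ‖covc r sch k (lowMain (rhoK sch k) (t * b 0) Low) (upMid (rhoK sch k) (t * b 0) (translateMulti (t • b) Up))‖ ≤ ε / 8 ∧
      ‖covc r sch k (lowMain (rhoK sch k) (t * b 0) Low) (upFar (rhoK sch k) (t * b 0) (translateMulti (t • b) Up))‖ ≤ ε / 8 ∧
      ‖covc r sch k (lowMid (rhoK sch k) (t * b 0) Low) (upMain (rhoK sch k) (t * b 0) (translateMulti (t • b) Up))‖ ≤ ε / 8 ∧
      ‖covc r sch k (lowMid (rhoK sch k) (t * b 0) Low) (upMid (rhoK sch k) (t * b 0) (translateMulti (t • b) Up))‖ ≤ ε / 8 ∧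
      ‖covc r sch k (lowMid (rhoK sch k) (t * b 0) Low) (upFar (rhoK sch k) (t * b 0) (translateMulti (t • b) Up))‖ ≤ ε / 8 ∧
      ‖covc r sch k (lowFar (rhoK sch k) Low) (upMain (rhoK sch k) (t * b 0) (translateMulti (t • b) Up))‖ ≤ ε / 8 ∧
      ‖covc r sch k (lowFar (rhoK sch k) Low) (upMid (rhoK sch k) (t * b 0) (translateMulti (t • b) Up))‖ ≤ ε / 8 ∧
      ‖covc r sch k (lowFar (rhoK sch k) Low) (upFar (rhoK sch k) (t * b 0) (translateMulti (t • b) Up))‖ ≤ ε / 8 := by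
  intro G _ _ _ _ _ _ r sch hvol hU n₁ n₂ Low Up b hLow hUp hb hLU ε hε
  have hε8 : 0 < ε / 8 := by positivity
  obtain ⟨t₁, h1⟩ := Tails.mid_lowMain_upMid r sch hU n₁ n₂ Low Up b hLow hUp hb hLU hε8
  obtain ⟨t₃, h3⟩ := Tails.mid_lowMid_upMain r sch hU n₁ n₂ Low Up b hLow hUp hb hLU hε8
  obtain ⟨t₄, h4⟩ := Tails.mid_lowMid_upMid r sch hU n₁ n₂ Low Up b hLow hUp hb hLU hε8
  refine ⟨max 0 (max t₁ (max t₃ t₄)), fun t ht => ?_⟩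
  have ht0 : 0 ≤ t := le_of_max_le_left ht
  have ht1 : t₁ ≤ t := le_of_max_le_left (le_of_max_le_right ht)
  have ht3 : t₃ ≤ t := le_of_max_le_left (le_of_max_le_right (le_of_max_le_right ht))
  have ht4 : t₄ ≤ t := le_of_max_le_right (le_of_max_le_right (le_of_max_le_right ht))
  filter_upwards [h1 t ht1, Tails.far_lowMain_upFar r sch hvol n₁ n₂ Low Up b hb hε8 t ht0, h3 t ht3, h4 t ht4,
    Tails.far_lowMid_upFar r sch hvol n₁ n₂ Low Up b hb hε8 t ht0, Tails.far_lowFar_upMain r sch hvol n₁ n₂ Low Up b hε8 t,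
    Tails.far_lowFar_upMid r sch hvol n₁ n₂ Low Up b hε8 t, Tails.far_lowFar_upFar r sch hvol n₁ n₂ Low Up b hε8 t]
    with k a1 a2 a3 a4 a5 a6 a7 a8
  exact ⟨a1, a2, a3, a4, a5, a6, a7, a8⟩

end Summit.QuantumFields.YangMills.Cruxes.ContinuumLimitOnTrajectory.TwoOrbitSynchronisation

end
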